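import Summits.QuantumFields.BalabanUV.Beta.GAN24.WardResidualRotatedVertexPeriodic
import Summits.QuantumFields.BalabanUV.Beta.GAN24.CoDressedColumnSourceSums

/-!
# `BalabanUV.Beta.GAN24.WardResidualRotatedVertexTotals` — binder row G-an2-4 ∕ (CONV-C), CT-W «WC-TL» → «QR-LL», the (S) row of RULING R-gan24p1-g27-1, Ward-type
# half (W-γ) in the PLAIN currency (leaf-06 g45 W4 (B)'s reduction «(W-γ)_plain ⟸ (T-F) `W^γ_κ = −W^{α⁺}_κ`»): **THE TOTAL (u-SUMMED) FIELD READ WEIGHTS OF THE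
# ROTATED-VERTEX LETTERS (α) AND (α⁺) IN CLOSED FORM** (road-P2 chair `b2b-balaban-gan24-p2`, gen 39, INTENT 2′ — the (α⁺) side of (T-F); the (γ) side is leaf-06's
# `GaugeReadCharge.tsum_read_eq_read_colProfile`)

NOT IN PRINT; OUR BOOKKEEPING ([folklore] one block regrouping + leaf-02 g51's co-dressed source sums BY NAME; 0 `def`, 0 cited fact, 0 `def … : Prop`, 0 sorry).  HONEST FRAMING
(cell contract, verbatim): «discharging `BetaPertH` makes Bałaban's UV stability UNCONDITIONAL — a real constructive-QFT result; it is NOT the continuum limit and NOT the Clay problem.»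
HONEST DEPENDENCY (verbatim): «continuum YM on T⁴ ⇐ BetaPertH ∧ nine spine estimates (0/9 proved); BetaPertH ⇐ (D1) ∧ (D4) ∧ CAP+tail; G-an2-4 gates asym, D1 and NE2/3/4.»

WHAT (comb kernel `G_j = coDressKBmAt ρ Lc (KInvStep Lc j)`, ANY level `j`, in-block root `ρ = toSite r`; label `y`, slot `(ν, y′)`, field direction `κ`).
* §1 `tsum_ite_blk_shift_eq` (the block behind a shifted block indicator), **`tsum_colH_comb_eq`** — THE TOTAL OF ONE COARSE COLUMN OVER ITS FIELD LEGS: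
  `T_{κν} := Σ'_u colH G_j ν y′ κ u = Σ_{v ∈ box} 𝟙[v_κ = Lc − 1]·Lc·colMass d Lc j κ ν` — slot-independent (`WardResidualRotatedVertexPeriodic.tsum_colH_mul_eq_blockSum_of_periodic`
  at `Z ≡ 1`, then `CoDressedColumnSourceSums.tsum_source_colH_coDressKBm_KInvStep` on every offset of the slot's block: only the EXIT slice carries source mass).
* §2 **`totalWeightEnd_eq`**: `Σ'_u colH G_j ν y′ κ u·(½𝟙[y′ + e_ν = y] − ½𝟙[blk (u + e_κ) = y]) = ½𝟙[y′ + e_ν = y]·T_{κν} − ½·Σ_{v∈box} colH G_j ν y′ κ (Lc•y + v − e_κ)` (the (α⁺) total read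
  weight `W^{α⁺}_κ(ν, y′)` of p2 g39's `WardResidualRotatedVertexInversion`); **`totalWeightBase_eq`**: the (α) twin `½𝟙[y′ = y]·T_{κν} − ½·Σ_{v∈box} colH G_j ν y′ κ (Lc•y + v)`.
  With SLOT-CONSTANT plain pair charges `ζ_κ` of the comb S-slot letters the plain charge of (α⁺) per slot is `½·Σ_κ ζ_κ·W^{α⁺}_κ(ν,y′)` + the multiplier half (whose pairings with
  the flat class vanish on the engine, E26g) — so (W-γ) in the plain currency is EXACTLY leaf-06's (T-F) «`W^γ_κ(ν,y′) = −W^{α⁺}_κ(ν,y′)`», engine-exact (E26b: 2.8e-14 ∕ 8.1e-14 ∕ 1.3e-14 at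
  D = 2 j = 0, j = 1, D = 3), NOT claimed here.
Asserts NO value of Bałaban's tables; discharges NOTHING of (S) ∕ (Q-R) ∕ (LT) ∕ (Q-L) ∕ (C) ∕ «T2Shape» ∕ «T2Drift» ∕ (hW, hWall); NEVER «G-an2-4 closed» as (CONV-C); NOT D1, NOT BetaPertH,
NOT continuum, NOT Clay.  2026-08-22; no existing file touched.
-/

noncomputable section

open Finset
open scoped BigOperators
open Literature.MathematicalPhysics.QuantumFieldTheory
open Literature.MathematicalPhysics.QuantumFieldTheory.Balaban1983to89
open Literature.MathematicalPhysics.QuantumFieldTheory.Balaban1983to89.Beta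
open ExpKernelCalculus (Site MKer Decays)
open AffineAveraging (box toSite)
open AveragingContours (blk blk_block)
open OneStepResolventKernel (Fib)
open OneStepKernelFamily (KInvStep colH abs_colH_le)
open Summit.QuantumFields.BalabanUV.Beta.AxialDressingRooted (coDressKBmAt decays_coDressKBmAt_KInvStep)
open Summit.QuantumFields.BalabanUV.Beta.GAN24.LinT2ZeroModeStep (colMass)
open Summit.QuantumFields.BalabanUV.Beta.GAN24.CoDressedColumnSourceSums (tsum_source_colH_coDressKBm_KInvStep)
open Summit.QuantumFields.BalabanUV.Beta.GAN24.WardResidualRotatedVertexDipole (tsum_ite_blk_eq)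
open Summit.QuantumFields.BalabanUV.Beta.GAN24.WardResidualRotatedVertexPeriodic (summable_colH_mul_of_bdd tsum_colH_mul_eq_blockSum_of_periodic)

namespace Summit.QuantumFields.BalabanUV.Beta.GAN24.WardResidualRotatedVertexTotals

variable {d Lc : ℕ} [NeZero Lc]

/-! ## §1 The total of one coarse column over its field legs -/

omit [NeZero Lc] in
/-- [folklore] The block sum behind a SHIFTED block indicator: `Σ'_u 𝟙[blk (u + s) = y]·F u = Σ_{v∈box} F (Lc•y + v − s)`. -/
theorem tsum_ite_blk_shift_eq (hLc : 1 ≤ Lc) (y s : Site (d + 1)) (F : Site (d + 1) → ℝ) :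
    ∑' u : Site (d + 1), (if blk Lc (u + s) = y then F u else 0) = ∑ v ∈ box (d + 1) Lc, F ((Lc : ℤ) • y + toSite v - s) := by
  rw [← (Equiv.subRight s).tsum_eq (fun u : Site (d + 1) => if blk Lc (u + s) = y then F u else 0)]
  simp only [Equiv.subRight_apply, sub_add_cancel]
  exact tsum_ite_blk_eq hLc y (fun u => F (u - s))

/-- NOT IN PRINT; OUR BOOKKEEPING.  **THE TOTAL OF ONE COARSE COLUMN OF THE COMB KERNEL OVER ITS FIELD LEGS**: for `G_j = coDressKBmAt ρ Lc (KInvStep Lc j)`, every slot `(ν, y′)`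
and field direction `κ`, `Σ'_u colH G_j ν y′ κ u = Σ_{v ∈ box} 𝟙[v_κ = Lc − 1]·Lc·colMass d Lc j κ ν` — the block regrouping
(`tsum_colH_mul_eq_blockSum_of_periodic` at `Z ≡ 1`) puts the source sum of the co-dressed column at every offset of the slot's block, and by leaf-02 g51's
`tsum_source_colH_coDressKBm_KInvStep` that source sum is `Lc·colMass` on the EXIT slice `v_κ = Lc − 1` and zero inside; in particular the total is SLOT-INDEPENDENT. -/
theorem tsum_colH_comb_eq {r : Fin (d + 1) → ℕ} (hr : r ∈ box (d + 1) Lc) (j : ℕ) (ν κ : Fin (d + 1)) (y' : Site (d + 1)) :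
    ∑' u : Site (d + 1), colH (coDressKBmAt (toSite r) Lc (KInvStep (d := d) Lc j)) Lc ν y' κ u
      = ∑ v ∈ box (d + 1) Lc, (if ((v κ : ℕ) : ℤ) = (Lc : ℤ) - 1 then (Lc : ℝ) * colMass d Lc j κ ν else 0) := by
  obtain ⟨δG, CG, hδG, hCG, hG⟩ := decays_coDressKBmAt_KInvStep (d := d) hr j
  have hs := summable_colH_mul_of_bdd (Lc := Lc) hG hδG ν κ y' (Z := fun _ => (1 : ℝ)) (B := 1) (fun _ => by rw [abs_one])
  have h := tsum_colH_mul_eq_blockSum_of_periodic r j ν κ y' (Z := fun _ => (1 : ℝ)) (fun _ _ => rfl) hs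
  simp only [mul_one] at h
  rw [h]
  refine Finset.sum_congr rfl fun v hv => ?_
  rw [tsum_source_colH_coDressKBm_KInvStep hr j ν κ]
  have hv' : ∀ i, v i < Lc := by simpa [AffineAveraging.box, Fintype.mem_piFinset, Finset.mem_range] using hv
  have e : ((Lc : ℤ) • y' + toSite v) κ % (Lc : ℤ) = ((v κ : ℕ) : ℤ) := by
    simp only [Pi.add_apply, Pi.smul_apply, toSite, smul_eq_mul]
    rw [add_comm, Int.add_mul_emod_self_left, Int.emod_eq_of_lt (by positivity) (by exact_mod_cast hv' κ)]
  rw [e]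


/-! ## §2 The total field read weights of (α⁺) and (α) -/

/-- NOT IN PRINT; OUR BOOKKEEPING.  **THE TOTAL FIELD READ WEIGHT OF THE END-POINT ROTATED VERTEX `(α⁺)`** (the u-sum of the field read vector of
`WardResidualRotatedVertexInversion.hasSum_weighted_rotatedVertexEnd_comb` at direction `κ`): `W^{α⁺}_κ(ν, y′) := Σ'_u colH G_j ν y′ κ u·(½𝟙[y′ + e_ν = y] − ½𝟙[blk (u + e_κ) = y])
= ½𝟙[y′ + e_ν = y]·T_{κν} − ½·Σ_{v∈box} colH G_j ν y′ κ (Lc•y + v − e_κ)` — the slot indicator times the column total of §1, minus half the column summed over the field legs ENDING in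
`B(y)`.  (Against SLOT-CONSTANT plain pair charges this is the whole field half of the plain charge of (α⁺); leaf-06 g45's (T-F) equates it with minus the (γ) total read weight.) -/
theorem totalWeightEnd_eq (hLc : 1 ≤ Lc) {r : Fin (d + 1) → ℕ} (hr : r ∈ box (d + 1) Lc) (j : ℕ) (y : Site (d + 1)) (ν κ : Fin (d + 1)) (y' : Site (d + 1)) :
    ∑' u : Site (d + 1), colH (coDressKBmAt (toSite r) Lc (KInvStep (d := d) Lc j)) Lc ν y' κ u
        * ((if y' + Pi.single ν 1 = y then (1 / 2 : ℝ) else 0) - (if blk Lc (u + Pi.single κ 1) = y then (1 / 2 : ℝ) else 0))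
      = (if y' + Pi.single ν 1 = y then (1 / 2 : ℝ) else 0) * (∑ v ∈ box (d + 1) Lc, (if ((v κ : ℕ) : ℤ) = (Lc : ℤ) - 1 then (Lc : ℝ) * colMass d Lc j κ ν else 0))
        - (1 / 2 : ℝ) * ∑ v ∈ box (d + 1) Lc, colH (coDressKBmAt (toSite r) Lc (KInvStep (d := d) Lc j)) Lc ν y' κ ((Lc : ℤ) • y + toSite v - Pi.single κ 1) := by
  obtain ⟨δG, CG, hδG, hCG, hG⟩ := decays_coDressKBmAt_KInvStep (d := d) hr j
  set a : ℝ := if y' + Pi.single ν 1 = y then (1 / 2 : ℝ) else 0 with ha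
  have h1 : Summable fun u : Site (d + 1) => colH (coDressKBmAt (toSite r) Lc (KInvStep (d := d) Lc j)) Lc ν y' κ u * a :=
    summable_colH_mul_of_bdd (Lc := Lc) hG hδG ν κ y' (Z := fun _ => a) (B := |a|) (fun _ => le_rfl)
  have h2 : Summable fun u : Site (d + 1) => colH (coDressKBmAt (toSite r) Lc (KInvStep (d := d) Lc j)) Lc ν y' κ u
      * (if blk Lc (u + Pi.single κ 1) = y then (1 / 2 : ℝ) else 0) :=
    summable_colH_mul_of_bdd (Lc := Lc) hG hδG ν κ y' (Z := fun u => if blk Lc (u + Pi.single κ 1) = y then (1 / 2 : ℝ) else 0) (B := 1 / 2)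
      (fun u => by split_ifs <;> norm_num)
  have e : ∀ u : Site (d + 1), colH (coDressKBmAt (toSite r) Lc (KInvStep (d := d) Lc j)) Lc ν y' κ u
      * (a - (if blk Lc (u + Pi.single κ 1) = y then (1 / 2 : ℝ) else 0))
      = colH (coDressKBmAt (toSite r) Lc (KInvStep (d := d) Lc j)) Lc ν y' κ u * a
        - colH (coDressKBmAt (toSite r) Lc (KInvStep (d := d) Lc j)) Lc ν y' κ u * (if blk Lc (u + Pi.single κ 1) = y then (1 / 2 : ℝ) else 0) :=
    fun u => by ring
  rw [tsum_congr e, h1.tsum_sub h2, tsum_mul_right, tsum_colH_comb_eq hr j ν κ y', mul_comm]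
  congr 1
  have e2 : ∀ u : Site (d + 1), colH (coDressKBmAt (toSite r) Lc (KInvStep (d := d) Lc j)) Lc ν y' κ u * (if blk Lc (u + Pi.single κ 1) = y then (1 / 2 : ℝ) else 0)
      = (if blk Lc (u + Pi.single κ 1) = y then colH (coDressKBmAt (toSite r) Lc (KInvStep (d := d) Lc j)) Lc ν y' κ u * (1 / 2 : ℝ) else 0) :=
    fun u => by split_ifs <;> simp
  rw [tsum_congr e2, tsum_ite_blk_shift_eq hLc y (Pi.single κ 1), Finset.mul_sum]
  exact Finset.sum_congr rfl fun v _ => by ring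

/-- NOT IN PRINT; OUR BOOKKEEPING.  **THE TOTAL FIELD READ WEIGHT OF THE BASE-POINT ROTATED VERTEX `(α)`** (the u-sum of the field read vector of
`WardResidualRotatedVertexWeighted.hasSum_weighted_rotatedVertex_comb` at direction `κ`): `W^{α}_κ(ν, y′) := Σ'_u colH G_j ν y′ κ u·(½𝟙[y′ = y] − ½𝟙[blk u = y])
= ½𝟙[y′ = y]·T_{κν} − ½·Σ_{v∈box} colH G_j ν y′ κ (Lc•y + v)`. -/
theorem totalWeightBase_eq (hLc : 1 ≤ Lc) {r : Fin (d + 1) → ℕ} (hr : r ∈ box (d + 1) Lc) (j : ℕ) (y : Site (d + 1)) (ν κ : Fin (d + 1)) (y' : Site (d + 1)) :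
    ∑' u : Site (d + 1), colH (coDressKBmAt (toSite r) Lc (KInvStep (d := d) Lc j)) Lc ν y' κ u
        * ((if y' = y then (1 / 2 : ℝ) else 0) - (if blk Lc u = y then (1 / 2 : ℝ) else 0))
      = (if y' = y then (1 / 2 : ℝ) else 0) * (∑ v ∈ box (d + 1) Lc, (if ((v κ : ℕ) : ℤ) = (Lc : ℤ) - 1 then (Lc : ℝ) * colMass d Lc j κ ν else 0))
        - (1 / 2 : ℝ) * ∑ v ∈ box (d + 1) Lc, colH (coDressKBmAt (toSite r) Lc (KInvStep (d := d) Lc j)) Lc ν y' κ ((Lc : ℤ) • y + toSite v) := by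
  obtain ⟨δG, CG, hδG, hCG, hG⟩ := decays_coDressKBmAt_KInvStep (d := d) hr j
  set a : ℝ := if y' = y then (1 / 2 : ℝ) else 0 with ha
  have h1 : Summable fun u : Site (d + 1) => colH (coDressKBmAt (toSite r) Lc (KInvStep (d := d) Lc j)) Lc ν y' κ u * a :=
    summable_colH_mul_of_bdd (Lc := Lc) hG hδG ν κ y' (Z := fun _ => a) (B := |a|) (fun _ => le_rfl)
  have h2 : Summable fun u : Site (d + 1) => colH (coDressKBmAt (toSite r) Lc (KInvStep (d := d) Lc j)) Lc ν y' κ u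
      * (if blk Lc u = y then (1 / 2 : ℝ) else 0) :=
    summable_colH_mul_of_bdd (Lc := Lc) hG hδG ν κ y' (Z := fun u => if blk Lc u = y then (1 / 2 : ℝ) else 0) (B := 1 / 2)
      (fun u => by split_ifs <;> norm_num)
  have e : ∀ u : Site (d + 1), colH (coDressKBmAt (toSite r) Lc (KInvStep (d := d) Lc j)) Lc ν y' κ u * (a - (if blk Lc u = y then (1 / 2 : ℝ) else 0))
      = colH (coDressKBmAt (toSite r) Lc (KInvStep (d := d) Lc j)) Lc ν y' κ u * a
        - colH (coDressKBmAt (toSite r) Lc (KInvStep (d := d) Lc j)) Lc ν y' κ u * (if blk Lc u = y then (1 / 2 : ℝ) else 0) := fun u => by ring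
  rw [tsum_congr e, h1.tsum_sub h2, tsum_mul_right, tsum_colH_comb_eq hr j ν κ y', mul_comm]
  congr 1
  have e2 : ∀ u : Site (d + 1), colH (coDressKBmAt (toSite r) Lc (KInvStep (d := d) Lc j)) Lc ν y' κ u * (if blk Lc u = y then (1 / 2 : ℝ) else 0)
      = (if blk Lc u = y then colH (coDressKBmAt (toSite r) Lc (KInvStep (d := d) Lc j)) Lc ν y' κ u * (1 / 2 : ℝ) else 0) :=
    fun u => by split_ifs <;> simp
  rw [tsum_congr e2, tsum_ite_blk_eq hLc y, Finset.mul_sum]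
  exact Finset.sum_congr rfl fun v _ => by ring

end Summit.QuantumFields.BalabanUV.Beta.GAN24.WardResidualRotatedVertexTotals

end
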